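import Literature.Geometry.Kaehler.ComplexTorusNonSimpleAbelianThreefoldTimesEllipticCurve
import Literature.Geometry.Kaehler.ComplexTorusAbelianSurfaceAbsoluteTypeDictionary
import Literature.Geometry.Kaehler.ComplexTorusHodgeGeneralTimesSameDimension
import HarnessLib

/-!
# Moonen–Zarhin 1999 Thm. (0.1) (4) for NON-SIMPLE complex abelian fourfolds: the Poincaré split `X ∼ T × E` or
# `X ∼ Y₁ × Y₂`, the products of two abelian surfaces with an isogenous or a non-simple factor ((5.5): «If `X₁` and
# `X₂` are isogenous then we are done»), and every fourfold with two elliptic isogeny factors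

Layer `Literature/Geometry/Kaehler`, namespace `Literature.Geometry.Kaehler.ComplexTorus`; lane `lit-hodgefound`
(Track 2 foundations library), Layer A4 (known cases of `D = B`), prover seat `lit-hodgefound-p17` (generation 51),
self-proposed row g51-#7 — the assembly, for fourfolds, of g51-#5 (`T × E_τ`, `T` simple outside case (a)), g51-#6
(`T × E_τ`, `T` non-simple; `(Y × E_{τ'}) × E_τ`) and the tree's «every abelian surface ∕ threefold satisfies (D)»
along the end of Moonen–Zarhin's proof of Thm. (0.1): «(5.4) Let `X` be a non-simple complex abelian fourfold. …
We can write `X ∼ X₁ × X₂^r` with `r ≥ 1` … If `r > 1` then we are reduced to the case `g ≤ 3`, since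
`Hg(X₁ × X₂^r) ≅ Hg(X₁ × X₂)`» and «(5.5) … This only leaves us with the case where `X ∼ X₁ × X₂`, with `X₁` and `X₂`
simple abelian surfaces. If `X₁` and `X₂` are isogenous then we are done. If `X₁` and `X₂` are not isogenous then
Proposition (4.2) shows that `Hg(X) = Hg(X₁) × Hg(X₂)`.»  THEOREMS ONLY (no definition, no instance, no notation, no
named fact; D-0026, net debt 0).  Proposition (4.2) (two NON-isogenous SIMPLE surfaces) and case (a) are not treated.

## Sources, VERBATIM (held `paper:arxiv-math_9901113`)

* B. J. J. Moonen, Yu. G. Zarhin [MoonenZarhin1999LowDim], *Hodge classes on abelian varieties of low dimension*, Math.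
  Ann. **315** (1999).  Thm. (0.1) (p0001 L126–L135): «Let `X` be a complex abelian variety with `dim(X) ≤ 4`. …
  (4) Suppose we are not in one of the cases (a), (b), (c) or (d). Then `Hg(X) = Sp_D(V,φ)` and `ℬ•(Xⁿ) = 𝒟•(Xⁿ)` for
  all `n`.»; cases (a)–(d) (p0001 L77–L95: (a) `X ∼ X₁ × X₂`, `X₁` a CM elliptic curve, `X₂` a simple threefold with
  `k ↪ End⁰(X₂)`; (b)–(d) `X` simple); §5 (5.4)–(5.5) (p0009 L82–L100), quoted above; §3 Cor. (3.9) (p0007 L80–L84).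
* H. P. F. Swinnerton-Dyer [SwinnertonDyer1974AbelianVarieties], *Analytic Theory of Abelian Varieties*, Ch. II §7
  Cor. 3 (pp. 57–58): a non-simple abelian manifold is isogenous to `Y × Z` with `Y` a proper subtorus and `Z` its
  complement (the tree's `IsRiemannForm.exists_isIsogenous_prod_of_not_isSimple`).
* B. B. Gordon [Gordon1997], *A survey of the Hodge conjecture for abelian varieties*, 7.6.1 («if `A` is stably
  nondegenerate then so is any power of `A`»), Thm. 7.5, 7.6.2.
* H. Lange [Lange2023AbelianVarietiesComplex], *Abelian Varieties over the Complex Numbers* (2023), §1.1.2 (products),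
  Cor. 1.1.16 (isogenous factors), §2.4.4 Thm. 2.4.25 (Poincaré's complete reducibility), §5.1.5 Exercise (2)(a).

## Contents

* §1 **`IsRiemannForm.forall_divisorClasses_powPeriod_prod_eq_hodgeClasses_of_isIsogenous_of_finrank_le_three`**: `X × X'`
  satisfies (D) for every polarised `X` of dimension `≤ 3` and every `X' ∼ X` (the tree's
  `IsIsogenous.forall_divisorClasses_powPeriod_prod_eq_hodgeClasses_of_forall_powPeriod_left`, `X × X' ∼ X²`, with g51-#2;
  «If `X₁` and `X₂` are isogenous then we are done», «reduced to the case `g ≤ 3`»).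
* §2 products of two polarised abelian SURFACES `Y₁ × Y₂`: (D) when `Y₁` or `Y₂` is NOT simple
  (`IsRiemannForm.forall_divisorClasses_powPeriod_prod_eq_hodgeClasses_of_not_isSimple_of_finrank_eq_two`, `…'`:
  `Y₁ × Y₂ ∼ (Y₂ × E_{σ₀}) × E_{σ₁}`, g51-#6), and — with the tree's isogenous case
  `IsIsogenous.forall_divisorClasses_powPeriod_prod_eq_hodgeClasses_of_finrank_eq_two` — the combined
  **`IsRiemannForm.forall_divisorClasses_powPeriod_prod_eq_hodgeClasses_of_finrank_eq_two_of_not_isSimple_or_isIsogenous`**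
  (everything except two non-isogenous simple surfaces, Prop. (4.2)).
* §3 **`IsRiemannForm.exists_isIsogenous_prod_of_not_isSimple_of_finrank_eq_four`**: a non-simple polarised fourfold is
  `X ∼ T × E_τ` with `T` a polarised abelian threefold (a Poincaré subtorus) or `X ∼ Y₁ × Y₂` with `Y₁, Y₂` polarised
  abelian surfaces (complementary Poincaré subtori).
* §4 (D) for fourfolds GIVEN an isogeny decomposition: **`IsIsogenous.forall_divisorClasses_powPeriod_eq_hodgeClasses_of_prod_ellipticPeriod_of_finrank_eq_three_of_forall_apply_ne`**
  (`X ∼ T × E_τ` outside case (a)), `…_of_prod_of_finrank_eq_two_of_not_isSimple_or_isIsogenous` (`X ∼ Y₁ × Y₂` not two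
  non-isogenous simple surfaces), and the unconditional **`IsIsogenous.forall_divisorClasses_powPeriod_eq_hodgeClasses_of_prod_prod_of_finrank_eq_one`**:
  EVERY complex torus isogenous to `(Y × C₁) × C₂` with `Y` a polarised abelian surface and `C₁, C₂` one-dimensional
  (two elliptic isogeny factors) satisfies (D).
-/

noncomputable section

open Module Matrix NumberField

namespace Literature.Geometry.Kaehler

namespace ComplexTorus

/-! ## §1 `X × X'` for `X' ∼ X`, `dim X ≤ 3` -/

section IsogenousLowDimension

variable {κ ι₂ : Type} [Fintype κ] [Fintype ι₂] [DecidableEq κ] [DecidableEq ι₂] {E E₂ : Type}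
  [NormedAddCommGroup E] [NormedSpace ℂ E] [FiniteDimensional ℂ E] [NormedAddCommGroup E₂] [NormedSpace ℂ E₂]
  {Ψ : (κ → ℝ) ≃L[ℝ] E} {η : E [⋀^Fin 2]→L[ℝ] ℝ} {Φ₂ : (ι₂ → ℝ) ≃L[ℝ] E₂}

/-- **`X × X'` SATISFIES CONDITION (D) FOR EVERY POLARISED `X` OF DIMENSION `≤ 3` AND EVERY `X' ∼ X`** (every complex
abelian variety of dimension `≤ 3` satisfies (D), g51-#2; `X × X' ∼ X²` and «if `A` is stably nondegenerate then so is
any power of `A`» — the tree's `IsIsogenous.forall_divisorClasses_powPeriod_prod_eq_hodgeClasses_of_forall_powPeriod_left`;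
«If `X₁` and `X₂` are isogenous then we are done», «reduced to the case `g ≤ 3`»).
[cite: MoonenZarhin1999LowDim, §5 (5.1)–(5.2) (p0008 L73–L111), (5.4)–(5.5) (p0009 L86–L99)] [cite: Gordon1997, Thm. 7.5 and 7.6.1] -/
theorem IsRiemannForm.forall_divisorClasses_powPeriod_prod_eq_hodgeClasses_of_isIsogenous_of_finrank_le_three
    (hη : IsRiemannForm Ψ η) (h0 : 0 < finrank ℂ E) (h3 : finrank ℂ E ≤ 3) (h : IsIsogenous Φ₂ Ψ) :
    ∀ k p, divisorClasses (powPeriod (prodPeriod Ψ Φ₂) k) p = hodgeClasses (powPeriod (prodPeriod Ψ Φ₂) k) p :=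
  h.forall_divisorClasses_powPeriod_prod_eq_hodgeClasses_of_forall_powPeriod_left Φ₂
    (hη.forall_divisorClasses_powPeriod_eq_hodgeClasses_of_finrank_le_three h0 h3)

end IsogenousLowDimension

/-! ## §2 Products of two abelian surfaces with a non-simple factor -/

section TwoSurfaces

variable {κ₁ κ₂ : Type} [Fintype κ₁] [Fintype κ₂] [DecidableEq κ₁] [DecidableEq κ₂] {E₁ E₂ : Type}
  [NormedAddCommGroup E₁] [NormedSpace ℂ E₁] [FiniteDimensional ℂ E₁] [NormedAddCommGroup E₂] [NormedSpace ℂ E₂]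
  [FiniteDimensional ℂ E₂] {Ψ₁ : (κ₁ → ℝ) ≃L[ℝ] E₁} {Ψ₂ : (κ₂ → ℝ) ≃L[ℝ] E₂} {η₁ : E₁ [⋀^Fin 2]→L[ℝ] ℝ}
  {η₂ : E₂ [⋀^Fin 2]→L[ℝ] ℝ}

/-- **`Y₁ × Y₂` SATISFIES CONDITION (D) WHEN THE POLARISED ABELIAN SURFACE `Y₁` IS NOT SIMPLE** (`Y₂` any polarised
abelian surface): `Y₁ ∼ E_{σ₀} × E_{σ₁}`, so `Y₁ × Y₂ ∼ (Y₂ × E_{σ₀}) × E_{σ₁}`, which satisfies (D) (g51-#6: (5.4)–(5.5) and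
Cor. (3.9)). [cite: MoonenZarhin1999LowDim, §5 (5.4)–(5.5) (p0009 L82–L97) and §3 Cor. (3.9)] [cite: Lange2023AbelianVarietiesComplex, §5.1.5 Exercise (2)(a) and §1.1.2] -/
theorem IsRiemannForm.forall_divisorClasses_powPeriod_prod_eq_hodgeClasses_of_not_isSimple_of_finrank_eq_two
    (hη₁ : IsRiemannForm Ψ₁ η₁) (h2₁ : finrank ℂ E₁ = 2) (hY₁ : ¬ IsSimple Ψ₁) (hη₂ : IsRiemannForm Ψ₂ η₂)
    (h2₂ : finrank ℂ E₂ = 2) :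
    ∀ k p, divisorClasses (powPeriod (prodPeriod Ψ₁ Ψ₂) k) p = hodgeClasses (powPeriod (prodPeriod Ψ₁ Ψ₂) k) p := by
  obtain ⟨σ₀, σ₁, hσ₀, hσ₁, hY⟩ :=
    hη₁.exists_isIsogenous_prodPeriod_ellipticPeriod_of_not_isSimple_of_finrank_eq_two h2₁ hY₁
  -- `Y₁ × Y₂ ∼ (E_{σ₀} × E_{σ₁}) × Y₂ ≅ Y₂ × (E_{σ₀} × E_{σ₁}) ≅ (Y₂ × E_{σ₀}) × E_{σ₁}`
  have hiso : IsIsogenous (prodPeriod Ψ₁ Ψ₂)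
      (prodPeriod (prodPeriod Ψ₂ (ellipticPeriod hσ₀)) (ellipticPeriod hσ₁)) :=
    IsIsogenous.trans _ _ _ (hY.prod (IsIsogenous.refl Ψ₂))
      ((isIsomorphic_prodPeriod_comm (prodPeriod (ellipticPeriod hσ₀) (ellipticPeriod hσ₁)) Ψ₂).trans
        (isIsomorphic_prodPeriod_assoc Ψ₂ (ellipticPeriod hσ₀) (ellipticPeriod hσ₁)).symm).isIsogenous
  exact hiso.forall_powPeriod_divisorClasses_eq_hodgeClasses_iff.2
    (hη₂.forall_divisorClasses_powPeriod_prod_ellipticPeriod_prod_ellipticPeriod_eq_hodgeClasses_of_finrank_eq_two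
      hσ₀ hσ₁ h2₂)

/-- The same with the SECOND factor non-simple: `Y₁ × Y₂` satisfies (D) when `Y₂` is not simple (`Y₁ × Y₂ ≅ Y₂ × Y₁`).
[cite: MoonenZarhin1999LowDim, §5 (5.4)–(5.5) (p0009 L82–L97) and §3 Cor. (3.9)] [cite: Lange2023AbelianVarietiesComplex, §1.1.2] -/
theorem IsRiemannForm.forall_divisorClasses_powPeriod_prod_eq_hodgeClasses_of_not_isSimple_of_finrank_eq_two'
    (hη₁ : IsRiemannForm Ψ₁ η₁) (h2₁ : finrank ℂ E₁ = 2) (hη₂ : IsRiemannForm Ψ₂ η₂) (h2₂ : finrank ℂ E₂ = 2)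
    (hY₂ : ¬ IsSimple Ψ₂) :
    ∀ k p, divisorClasses (powPeriod (prodPeriod Ψ₁ Ψ₂) k) p = hodgeClasses (powPeriod (prodPeriod Ψ₁ Ψ₂) k) p :=
  (isIsomorphic_prodPeriod_comm Ψ₁ Ψ₂).isIsogenous.forall_powPeriod_divisorClasses_eq_hodgeClasses_iff.2
    (hη₂.forall_divisorClasses_powPeriod_prod_eq_hodgeClasses_of_not_isSimple_of_finrank_eq_two h2₂ hY₂ hη₁ h2₁)

/-- **MOONEN–ZARHIN THM. (0.1) (4) FOR PRODUCTS OF TWO POLARISED ABELIAN SURFACES, ALL CASES EXCEPT PROP. (4.2)**: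
`Y₁ × Y₂` satisfies condition (D) whenever `Y₁` or `Y₂` is not simple, or `Y₂ ∼ Y₁` («This only leaves us with the case
where `X ∼ X₁ × X₂`, with `X₁` and `X₂` simple abelian surfaces. If `X₁` and `X₂` are isogenous then we are done.»; the
remaining case — two non-isogenous simple surfaces, `Hg(X) = Hg(X₁) × Hg(X₂)` by Prop. (4.2) — is not treated here).
[cite: MoonenZarhin1999LowDim, §5 (5.5) (p0009 L93–L100) and Thm. (0.1) (4) (p0001 L131–L135)] -/
theorem IsRiemannForm.forall_divisorClasses_powPeriod_prod_eq_hodgeClasses_of_finrank_eq_two_of_not_isSimple_or_isIsogenous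
    (hη₁ : IsRiemannForm Ψ₁ η₁) (hη₂ : IsRiemannForm Ψ₂ η₂) (h2₁ : finrank ℂ E₁ = 2) (h2₂ : finrank ℂ E₂ = 2)
    (h : ¬ IsSimple Ψ₁ ∨ ¬ IsSimple Ψ₂ ∨ IsIsogenous Ψ₂ Ψ₁) :
    ∀ k p, divisorClasses (powPeriod (prodPeriod Ψ₁ Ψ₂) k) p = hodgeClasses (powPeriod (prodPeriod Ψ₁ Ψ₂) k) p := by
  rcases h with h | h | h
  · exact hη₁.forall_divisorClasses_powPeriod_prod_eq_hodgeClasses_of_not_isSimple_of_finrank_eq_two h2₁ h hη₂ h2₂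
  · exact hη₁.forall_divisorClasses_powPeriod_prod_eq_hodgeClasses_of_not_isSimple_of_finrank_eq_two' h2₁ hη₂ h2₂ h
  · exact h.forall_divisorClasses_powPeriod_prod_eq_hodgeClasses_of_finrank_eq_two Ψ₂ ⟨η₁, hη₁⟩ h2₁

/-- The `IsAbelianVariety` form: `Y₁ × Y₂` satisfies (D) for complex abelian surfaces `Y₁, Y₂` with `Y₁` or `Y₂` not simple
or `Y₂ ∼ Y₁`. [cite: MoonenZarhin1999LowDim, §5 (5.5) (p0009 L93–L100)] -/
theorem IsAbelianVariety.forall_divisorClasses_powPeriod_prod_eq_hodgeClasses_of_finrank_eq_two_of_not_isSimple_or_isIsogenous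
    (hA₁ : IsAbelianVariety Ψ₁) (hA₂ : IsAbelianVariety Ψ₂) (h2₁ : finrank ℂ E₁ = 2) (h2₂ : finrank ℂ E₂ = 2)
    (h : ¬ IsSimple Ψ₁ ∨ ¬ IsSimple Ψ₂ ∨ IsIsogenous Ψ₂ Ψ₁) :
    ∀ k p, divisorClasses (powPeriod (prodPeriod Ψ₁ Ψ₂) k) p = hodgeClasses (powPeriod (prodPeriod Ψ₁ Ψ₂) k) p := by
  obtain ⟨η₁, hη₁⟩ := hA₁
  obtain ⟨η₂, hη₂⟩ := hA₂
  exact hη₁.forall_divisorClasses_powPeriod_prod_eq_hodgeClasses_of_finrank_eq_two_of_not_isSimple_or_isIsogenous hη₂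
    h2₁ h2₂ h

end TwoSurfaces

/-! ## §3 The Poincaré split of a non-simple abelian fourfold: `X ∼ T × E_τ` or `X ∼ Y₁ × Y₂` -/

section Fourfold

variable {κ : Type} [Fintype κ] [DecidableEq κ] {E : Type} [NormedAddCommGroup E] [NormedSpace ℂ E]
  [FiniteDimensional ℂ E] {Ψ : (κ → ℝ) ≃L[ℝ] E} {η : E [⋀^Fin 2]→L[ℝ] ℝ}

/-- **A NON-SIMPLE POLARISED ABELIAN FOURFOLD IS `X ∼ T × E_τ` WITH `T` A POLARISED ABELIAN THREEFOLD, OR `X ∼ Y₁ × Y₂`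
WITH `Y₁, Y₂` POLARISED ABELIAN SURFACES** — `T`, `Y₁` ∕ `Y₂` Poincaré subtori of `X` (polarised by restriction of the
Riemann form), `E_τ ≅` a one-dimensional complementary subtorus («Let `X` be a non-simple complex abelian fourfold. …
We can write `X ∼ X₁ × X₂^r`»: the dimension pairs `(3,1)`, `(1,3)`, `(2,2)`).
[cite: MoonenZarhin1999LowDim, §5 (5.4)–(5.5) (p0009 L82–L100)] [cite: SwinnertonDyer1974AbelianVarieties, Ch. II §7 Cor. 3 (pp. 57–58)]
[cite: Lange2023AbelianVarietiesComplex, §2.4.4 Thm. 2.4.25 and §1.1.6 Exercise (1)(a)] -/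
theorem IsRiemannForm.exists_isIsogenous_prod_of_not_isSimple_of_finrank_eq_four (hη : IsRiemannForm Ψ η)
    (h4 : finrank ℂ E = 4) (hX : ¬ IsSimple Ψ) :
    (∃ (V : Submodule ℝ (κ → ℝ)) (hV : IsLatticeSubspace V) (hVc : IsComplexSubspace Ψ V) (τ : ℂ) (hτ : τ.im ≠ 0),
      finrank ℂ (cxSpan Ψ V) = 3 ∧ IsIsogenous Ψ (prodPeriod (subtorusPeriod Ψ V hV hVc) (ellipticPeriod hτ))) ∨
    (∃ (V : Submodule ℝ (κ → ℝ)) (hV : IsLatticeSubspace V) (hVc : IsComplexSubspace Ψ V)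
      (hW : IsLatticeSubspace (orthSubspace Ψ η V)) (hWc : IsComplexSubspace Ψ (orthSubspace Ψ η V)),
      finrank ℂ (cxSpan Ψ V) = 2 ∧ finrank ℂ (cxSpan Ψ (orthSubspace Ψ η V)) = 2 ∧
        IsIsogenous Ψ (prodPeriod (subtorusPeriod Ψ V hV hVc) (subtorusPeriod Ψ (orthSubspace Ψ η V) hW hWc))) := by
  obtain ⟨V, hV, hVc, hW, hWc, h1, h2, hiso⟩ := hη.exists_isIsogenous_prod_of_not_isSimple Ψ hX
  have hcard := hiso.card_eq
  rw [Fintype.card_sum, Fintype.card_fin, Fintype.card_fin, card_eq_two_mul_finrank Ψ, h4] at hcard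
  have hV2 := subRank_eq_two_mul_finrank Ψ hV hVc
  have hW2 := subRank_eq_two_mul_finrank Ψ hW hWc
  have habc : (finrank ℂ (cxSpan Ψ V) = 3 ∧ finrank ℂ (cxSpan Ψ (orthSubspace Ψ η V)) = 1) ∨
      (finrank ℂ (cxSpan Ψ V) = 1 ∧ finrank ℂ (cxSpan Ψ (orthSubspace Ψ η V)) = 3) ∨
      (finrank ℂ (cxSpan Ψ V) = 2 ∧ finrank ℂ (cxSpan Ψ (orthSubspace Ψ η V)) = 2) := by omega
  rcases habc with ⟨ha, hb⟩ | ⟨ha, hb⟩ | ⟨ha, hb⟩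
  · -- `X ∼ π(V) × π(V^⊥)` with `π(V^⊥)` an elliptic curve `≅ E_τ`
    obtain ⟨τ, hτ, e⟩ := exists_isIsomorphic_ellipticPeriod (subtorusPeriod Ψ (orthSubspace Ψ η V) hW hWc) hb
    exact Or.inl ⟨V, hV, hVc, τ, hτ, ha, IsIsogenous.trans _ _ _ hiso
      ((IsIsomorphic.refl (subtorusPeriod Ψ V hV hVc)).prod e).isIsogenous⟩
  · -- `π(V)` is the elliptic curve: swap the factors, `T = π(V^⊥)`
    obtain ⟨τ, hτ, e⟩ := exists_isIsomorphic_ellipticPeriod (subtorusPeriod Ψ V hV hVc) ha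
    refine Or.inl ⟨orthSubspace Ψ η V, hW, hWc, τ, hτ, hb, IsIsogenous.trans _ _ _ hiso ?_⟩
    exact ((e.prod (IsIsomorphic.refl (subtorusPeriod Ψ (orthSubspace Ψ η V) hW hWc))).trans
      (isIsomorphic_prodPeriod_comm (ellipticPeriod hτ) (subtorusPeriod Ψ (orthSubspace Ψ η V) hW hWc))).isIsogenous
  · exact Or.inr ⟨V, hV, hVc, hW, hWc, ha, hb, hiso⟩

end Fourfold

/-! ## §4 Condition (D) for fourfolds with a given isogeny decomposition -/

section Decomposed

variable {ι : Type*} [Fintype ι] [DecidableEq ι] {F : Type*} [NormedAddCommGroup F] [NormedSpace ℂ F]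
  {Φ : (ι → ℝ) ≃L[ℝ] F}
  {κ : Type} [Fintype κ] [DecidableEq κ] [Nonempty κ] {E : Type} [NormedAddCommGroup E] [NormedSpace ℂ E]
  [FiniteDimensional ℂ E] {Ψ : (κ → ℝ) ≃L[ℝ] E} {η : E [⋀^Fin 2]→L[ℝ] ℝ} {τ : ℂ} (hτ : τ.im ≠ 0)

/-- **THM. (0.1) (4) FOR `X ∼ T × E_τ` OUTSIDE CASE (a)**: a complex torus isogenous to `T × E_τ` — `T` a polarised abelian
threefold, `E_τ` an elliptic curve, and, when `T` is simple and `E_τ` has complex multiplication by `k = ℚ(τ)`, no ring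
embedding of the centre of `End⁰(T)` taking the value `τ` — satisfies condition (D): `ℬ•(Xⁿ) = 𝒟•(Xⁿ)` for all `n`.
[cite: MoonenZarhin1999LowDim, Thm. (0.1) (4) (p0001 L131–L135), case (a) (p0001 L77–L80) and §5 (5.4)–(5.5) (p0009 L82–L97)]
[cite: Gordon1997, Thm. 7.5 and 7.6.1–7.6.2] -/
theorem IsIsogenous.forall_divisorClasses_powPeriod_eq_hodgeClasses_of_prod_ellipticPeriod_of_finrank_eq_three_of_forall_apply_ne
    (hiso : IsIsogenous Φ (prodPeriod Ψ (ellipticPeriod hτ))) (hη : IsRiemannForm Ψ η) (h3 : finrank ℂ E = 3)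
    (ha : ∀ hX : IsSimple Ψ, ellipticEnd hτ ≠ ⊥ → ∀ φ : centerField Ψ hX →+* ℂ, ∀ c, φ c ≠ τ) :
    ∀ k p, divisorClasses (powPeriod Φ k) p = hodgeClasses (powPeriod Φ k) p :=
  hiso.forall_powPeriod_divisorClasses_eq_hodgeClasses_iff.2
    (hη.forall_divisorClasses_powPeriod_prod_ellipticPeriod_eq_hodgeClasses_of_finrank_eq_three_of_forall_apply_ne hτ h3 ha)

omit [Nonempty κ] in
/-- **`X ∼ T × E_τ` WITH `T` A NON-SIMPLE POLARISED THREEFOLD ⟹ `X` satisfies (D)**, every `E_τ`.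
[cite: MoonenZarhin1999LowDim, §5 (5.4)–(5.5) (p0009 L82–L97) and Thm. (0.1) (4)] -/
theorem IsIsogenous.forall_divisorClasses_powPeriod_eq_hodgeClasses_of_prod_ellipticPeriod_of_not_isSimple_of_finrank_eq_three
    (hiso : IsIsogenous Φ (prodPeriod Ψ (ellipticPeriod hτ))) (hη : IsRiemannForm Ψ η) (h3 : finrank ℂ E = 3)
    (hT : ¬ IsSimple Ψ) : ∀ k p, divisorClasses (powPeriod Φ k) p = hodgeClasses (powPeriod Φ k) p :=
  hiso.forall_powPeriod_divisorClasses_eq_hodgeClasses_iff.2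
    (hη.forall_divisorClasses_powPeriod_prod_ellipticPeriod_eq_hodgeClasses_of_not_isSimple_of_finrank_eq_three hτ h3 hT)

omit [Nonempty κ] in
/-- **`X ∼ T × E_τ` WITH `E_τ` WITHOUT COMPLEX MULTIPLICATION ⟹ `X` satisfies (D)**, every polarised threefold `T`.
[cite: MoonenZarhin1999LowDim, §5 (5.4) (p0009 L82–L91) and Thm. (0.1) (4)] [cite: Gordon1997, Thm. 7.5] -/
theorem IsIsogenous.forall_divisorClasses_powPeriod_eq_hodgeClasses_of_prod_ellipticPeriod_of_finrank_eq_three_of_ellipticEnd_eq_bot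
    (hiso : IsIsogenous Φ (prodPeriod Ψ (ellipticPeriod hτ))) (hη : IsRiemannForm Ψ η) (h3 : finrank ℂ E = 3)
    (hE : ellipticEnd hτ = ⊥) : ∀ k p, divisorClasses (powPeriod Φ k) p = hodgeClasses (powPeriod Φ k) p :=
  hiso.forall_powPeriod_divisorClasses_eq_hodgeClasses_iff.2
    (hη.forall_divisorClasses_powPeriod_prod_ellipticPeriod_eq_hodgeClasses_of_finrank_eq_three_of_ellipticEnd_eq_bot hτ h3 hE)

end Decomposed

section DecomposedSurfaces

variable {ι : Type*} [Fintype ι] [DecidableEq ι] {F : Type*} [NormedAddCommGroup F] [NormedSpace ℂ F]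
  {Φ : (ι → ℝ) ≃L[ℝ] F}
  {κ₁ κ₂ : Type} [Fintype κ₁] [Fintype κ₂] [DecidableEq κ₁] [DecidableEq κ₂] {E₁ E₂ : Type}
  [NormedAddCommGroup E₁] [NormedSpace ℂ E₁] [FiniteDimensional ℂ E₁] [NormedAddCommGroup E₂] [NormedSpace ℂ E₂]
  [FiniteDimensional ℂ E₂] {Ψ₁ : (κ₁ → ℝ) ≃L[ℝ] E₁} {Ψ₂ : (κ₂ → ℝ) ≃L[ℝ] E₂} {η₁ : E₁ [⋀^Fin 2]→L[ℝ] ℝ}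
  {η₂ : E₂ [⋀^Fin 2]→L[ℝ] ℝ}

/-- **`X ∼ Y₁ × Y₂` WITH `Y₁, Y₂` POLARISED ABELIAN SURFACES, NOT TWO NON-ISOGENOUS SIMPLE ONES ⟹ `X` satisfies (D).**
[cite: MoonenZarhin1999LowDim, §5 (5.5) (p0009 L93–L100) and Thm. (0.1) (4)] -/
theorem IsIsogenous.forall_divisorClasses_powPeriod_eq_hodgeClasses_of_prod_of_finrank_eq_two_of_not_isSimple_or_isIsogenous
    (hiso : IsIsogenous Φ (prodPeriod Ψ₁ Ψ₂)) (hη₁ : IsRiemannForm Ψ₁ η₁) (hη₂ : IsRiemannForm Ψ₂ η₂)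
    (h2₁ : finrank ℂ E₁ = 2) (h2₂ : finrank ℂ E₂ = 2) (h : ¬ IsSimple Ψ₁ ∨ ¬ IsSimple Ψ₂ ∨ IsIsogenous Ψ₂ Ψ₁) :
    ∀ k p, divisorClasses (powPeriod Φ k) p = hodgeClasses (powPeriod Φ k) p :=
  hiso.forall_powPeriod_divisorClasses_eq_hodgeClasses_iff.2
    (hη₁.forall_divisorClasses_powPeriod_prod_eq_hodgeClasses_of_finrank_eq_two_of_not_isSimple_or_isIsogenous hη₂ h2₁
      h2₂ h)

end DecomposedSurfaces

section TwoEllipticFactors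

variable {ι ι₁ ι₂ : Type*} [Fintype ι] [Fintype ι₁] [Fintype ι₂] [DecidableEq ι] [DecidableEq ι₁] [DecidableEq ι₂]
  {F F₁ F₂ : Type*} [NormedAddCommGroup F] [NormedSpace ℂ F] [NormedAddCommGroup F₁] [NormedSpace ℂ F₁]
  [NormedAddCommGroup F₂] [NormedSpace ℂ F₂] {Φ : (ι → ℝ) ≃L[ℝ] F} {Θ₁ : (ι₁ → ℝ) ≃L[ℝ] F₁} {Θ₂ : (ι₂ → ℝ) ≃L[ℝ] F₂}
  {κ : Type} [Fintype κ] [DecidableEq κ] {E : Type} [NormedAddCommGroup E] [NormedSpace ℂ E] [FiniteDimensional ℂ E]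
  {Ψ : (κ → ℝ) ≃L[ℝ] E} {η : E [⋀^Fin 2]→L[ℝ] ℝ}

/-- **EVERY COMPLEX TORUS ISOGENOUS TO `(Y × C₁) × C₂` WITH `Y` A POLARISED ABELIAN SURFACE AND `C₁`, `C₂` ONE-DIMENSIONAL
COMPLEX TORI SATISFIES CONDITION (D)** — a fourfold with two elliptic isogeny factors is never in case (a) (there `X₂` is a
SIMPLE threefold): `C_i ≅ E_{τ_i}` and `(Y × E_{τ₁}) × E_{τ₂}` satisfies (D) (g51-#6).
[cite: MoonenZarhin1999LowDim, Thm. (0.1) (4) (p0001 L131–L135), §5 (5.4)–(5.5) (p0009 L82–L97) and §3 Cor. (3.9)] [cite: Gordon1997, Thm. 7.5] -/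
theorem IsIsogenous.forall_divisorClasses_powPeriod_eq_hodgeClasses_of_prod_prod_of_finrank_eq_one
    (hiso : IsIsogenous Φ (prodPeriod (prodPeriod Ψ Θ₁) Θ₂)) (hη : IsRiemannForm Ψ η) (h2 : finrank ℂ E = 2)
    (h₁ : finrank ℂ F₁ = 1) (h₂ : finrank ℂ F₂ = 1) :
    ∀ k p, divisorClasses (powPeriod Φ k) p = hodgeClasses (powPeriod Φ k) p := by
  obtain ⟨τ₁, hτ₁, e₁⟩ := exists_isIsomorphic_ellipticPeriod Θ₁ h₁
  obtain ⟨τ₂, hτ₂, e₂⟩ := exists_isIsomorphic_ellipticPeriod Θ₂ h₂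
  exact (IsIsogenous.trans _ _ _ hiso (((IsIsomorphic.refl Ψ).prod e₁).prod e₂).isIsogenous)
    |>.forall_powPeriod_divisorClasses_eq_hodgeClasses_iff.2
      (hη.forall_divisorClasses_powPeriod_prod_ellipticPeriod_prod_ellipticPeriod_eq_hodgeClasses_of_finrank_eq_two hτ₁ hτ₂ h2)

/-- The same read for `X = (Y × C₁) × C₂` itself (no isogeny): `(Y × C₁) × C₂` satisfies (D) for every polarised abelian
surface `Y` and all one-dimensional complex tori `C₁`, `C₂`. [cite: MoonenZarhin1999LowDim, Thm. (0.1) (4) and §5 (5.4)–(5.5) (p0009 L82–L97)] -/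
theorem IsRiemannForm.forall_divisorClasses_powPeriod_prod_prod_eq_hodgeClasses_of_finrank_eq_two_of_finrank_eq_one
    (hη : IsRiemannForm Ψ η) (h2 : finrank ℂ E = 2) (h₁ : finrank ℂ F₁ = 1) (h₂ : finrank ℂ F₂ = 1) :
    ∀ k p, divisorClasses (powPeriod (prodPeriod (prodPeriod Ψ Θ₁) Θ₂) k) p =
      hodgeClasses (powPeriod (prodPeriod (prodPeriod Ψ Θ₁) Θ₂) k) p :=
  (IsIsogenous.refl _).forall_divisorClasses_powPeriod_eq_hodgeClasses_of_prod_prod_of_finrank_eq_one hη h2 h₁ h₂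

end TwoEllipticFactors

end ComplexTorus

end Literature.Geometry.Kaehler
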